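import Literature.AlgebraicGeometry.Resolution.AffineBlowup
import Literature.AlgebraicGeometry.Resolution.AffineBlowupIntegral
import Literature.AlgebraicGeometry.Resolution.NormalizationOfVarieties
import Mathlib.AlgebraicGeometry.Noetherian
import Mathlib.AlgebraicGeometry.FunctionField
import Mathlib.RingTheory.DedekindDomain.Basic
import Mathlib.RingTheory.RegularLocalRing.Defs
import HarnessLib

/-!
# R₁ for a normal blowing up: low-dimensional points of `Bl_I(Spec A)` are regular

Support file for crux stmt-ResolutionOfSingularities-15960
(`SectionAscent.FibrewiseClosedPoints`, line `registered`): stub `stub_lowDimPoint` of the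
closed-point section criterion.

For a Noetherian domain `A`, a nonzero ideal `I` and a point `y` of the blowing up
`Bl_I(Spec A) = affineBlowup I = Proj A[It]`, the stalk `𝒪_y` is

* a local ring (stalk of a scheme),
* a domain — `Bl_I(Spec A)` is an integral scheme (`affineBlowup.isIntegral`, Stacks 02ND) and
  stalks of integral schemes are domains (Mathlib),
* Noetherian — `Bl_I(Spec A) → Spec A` is proper (`affineBlowup.isProper`), in particular locally
  of finite type, so `Bl_I(Spec A)` is locally Noetherian
  (`LocallyOfFiniteType.isLocallyNoetherian`) and stalks of locally Noetherian schemes are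
  Noetherian (Mathlib).

Hence if `𝒪_y` is integrally closed and `dim 𝒪_y ≤ 1` it is a (local) Dedekind domain, i.e. a
field or a discrete valuation ring, and therefore a regular local ring (Mathlib:
`IsDedekindDomain R → IsRegularRing R`, `IsRegularLocalRing.of_isRegularRing_of_isLocalRing`).
This is Serre's condition R₁ read off at a single point of a normal scheme.

References: H. Matsumura, *Commutative Ring Theory*, Thm. 11.2 (integrally closed Noetherian
local domains of dimension one are DVRs) and Thm. 23.8 (normal ⇔ R₁ + S₂); The Stacks Project,
Tag 02ND (blowing up an integral scheme in a nonzero ideal is integral).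
-/

-- single-problem summit: the doubled namespace component is forced
set_option linter.dupNamespace false

namespace Summit.ResolutionOfSingularities.ResolutionOfSingularities.Theorems.SectionAscent.LowDimPoint

open AlgebraicGeometry Literature.AlgebraicGeometry.Resolution

/-- The blowing up `Bl_I(Spec A)` of a Noetherian affine scheme is locally Noetherian: it is
proper, in particular locally of finite type, over `Spec A`. [folklore] -/
theorem isLocallyNoetherian_affineBlowup {A : Type} [CommRing A] [IsNoetherianRing A]
    (I : Ideal A) : IsLocallyNoetherian (affineBlowup I) :=
  LocallyOfFiniteType.isLocallyNoetherian (affineBlowup.π I)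

/-- The stalks of the blowing up `Bl_I(Spec A)` of a Noetherian affine scheme are Noetherian
(localizations of the Noetherian chart rings). [folklore] -/
theorem isNoetherianRing_stalk_affineBlowup {A : Type} [CommRing A] [IsNoetherianRing A]
    (I : Ideal A) (y : affineBlowup I) :
    IsNoetherianRing ((affineBlowup I).presheaf.stalk y) :=
  haveI := isLocallyNoetherian_affineBlowup I
  inferInstance

/-- The stalks of the blowing up `Bl_I(Spec A)` of an integral affine scheme along a nonzero
ideal are domains (`Bl_I(Spec A)` is integral). [cite: StacksProject, Tag 02ND] -/
theorem isDomain_stalk_affineBlowup {A : Type} [CommRing A] [IsDomain A] {I : Ideal A}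
    (hI : I ≠ ⊥) (y : affineBlowup I) : IsDomain ((affineBlowup I).presheaf.stalk y) :=
  haveI := affineBlowup.isIntegral hI
  inferInstance

/-- An integrally closed Noetherian local domain of Krull dimension `≤ 1` is a regular local ring:
it is a local Dedekind domain (dimension `≤ 1` in the sense of `Ring.DimensionLEOne` by the tree
lemma `Ring.DimensionLEOne.of_ringKrullDim_le_one`), i.e. a field or a discrete valuation ring.
[cite: Matsumura1987, Thm. 11.2] -/
theorem isRegularLocalRing_of_isIntegrallyClosed_of_ringKrullDim_le_one (S : Type*) [CommRing S]
    [IsDomain S] [IsLocalRing S] [IsNoetherianRing S] (hnorm : IsIntegrallyClosed S)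
    (hdim : ringKrullDim S ≤ 1) : IsRegularLocalRing S := by
  haveI : Ring.DimensionLEOne S :=
    Literature.AlgebraicGeometry.Resolution.Ring.DimensionLEOne.of_ringKrullDim_le_one hdim
  haveI : IsDedekindRing S := { }
  exact IsRegularLocalRing.of_isRegularRing_of_isLocalRing S

/-- STUB `stub_lowDimPoint` of line `registered` (crux `SectionAscent.FibrewiseClosedPoints`).
**R₁ for a normal blowing up.** For a Noetherian domain `A`, `I ≠ 0`, and a point `y` of
`Bl_I(Spec A)` whose local ring is integrally closed and of Krull dimension `≤ 1`, the local ring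
at `y` is regular: it is a Noetherian local domain (`Bl_I(Spec A)` is integral and locally
Noetherian), hence a local Dedekind domain — a field in dimension `0`, a discrete valuation ring
in dimension `1` — and both are regular. [cite: Matsumura1987, Thm. 11.2 and Thm. 23.8 (R₁)] -/
theorem stub_lowDimPoint (A : Type) [CommRing A] [IsDomain A] [IsNoetherianRing A]
    (I : Ideal A) (hI : I ≠ ⊥) (y : Literature.AlgebraicGeometry.Resolution.affineBlowup I)
    (hnorm : IsIntegrallyClosed ((Literature.AlgebraicGeometry.Resolution.affineBlowup I).presheaf.stalk y))
    (hdim : ringKrullDim ((Literature.AlgebraicGeometry.Resolution.affineBlowup I).presheaf.stalk y) ≤ 1) :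
    IsRegularLocalRing ((Literature.AlgebraicGeometry.Resolution.affineBlowup I).presheaf.stalk y) := by
  haveI := isDomain_stalk_affineBlowup hI y
  haveI := isNoetherianRing_stalk_affineBlowup I y
  exact isRegularLocalRing_of_isIntegrallyClosed_of_ringKrullDim_le_one _ hnorm hdim

end Summit.ResolutionOfSingularities.ResolutionOfSingularities.Theorems.SectionAscent.LowDimPoint
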